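import Summits.QuantumFields.BalabanUV.T4Continuum.Support.RegionGaugeSliceTorus

/-!
# T⁴ programme, spine node NE2 (U1a), sub-row Δ1 «NE2⁰-Dirichlet» — THE TWO-ZONE `U = 1` REGION VECTOR OPERATOR
# «Ω₁ ⊂ Ω₀, unit averaging on Ω₁, η-scale mass on the collar, gauge functions supported in Ω₁» TYPED, its `SliceData` PROVED,
# «G₂(Ω₀) exists» UNCONDITIONALLY, and its bound ⟺ ONE displayed slice inequality `SliceCoercive₂`

NE2 formalisation swarm `b2b-balaban-t4-ne2-formalise-*`, leaf 07 (gen 6), supplier item «Δ1-COERC-2Z» = owner ruling R25 (c) (journal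
2026-08-20 l.17120: «TWO-ZONE model: Ω₁ ⊂ Ω₀, unit averaging on Ω₁, η-scale mass a·n² on the star bonds of the collar Λ₀ = Ω₀∖Ω₁ ((3.16) j = 0),
gauge functions supported in Ω₁ ((3.18)/(3.22)) … an operator `regionDeltaA₂ n M a a′ S₀ S₁` on the STAR bonds of Ω₀ = blockReg S₀ with `gradR`
columns = blockReg S₁, `SliceData` proved, coercivity ⟸ ONE displayed slice inequality»), CLAIMED l.17403; file 1 of 2 (file 2
`Support/RegionGaugeTwoZoneTransfer.lean`: the two-zone slice inequality is EQUIVALENT, constants `d`, `a` only, to the single-zone one of Ω₁).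

WHAT IS PRINTED ([Balaban1985BackgroundPropagators] pp. 393–394, OCR `paper:balaban1985-cmp99-background-propagators` p0005–p0006 read by gen 5,
quoted in `t4/T4-EST-NE2-D1-COERC.md` §4): «(AQ*aQA) = Σ_{j=0}^{k} a (L^jη)^{d−2} Σ_{b∈Λ_j} |(Q_j(U)A)(b)|²» (3.16) — the `j = 0` term on the collar
`Λ₀` is an η-scale MASS (no averaging); «(Q′λ)(y) = (Q′_j(U)λ)(y) for y ∈ Λ_j^{(j)}» (3.18), whence «the functions λ in (3.22) vanish on Ω₁ᶜ» (p. 394).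
The cell's single-zone model (`RegionGaugeFixedVector.regionDeltaA`, ONE unit-scale averaging on all of Ω₀) drops this structure; THIS FILE types
the simplest faithful version of it — TWO zones, ONE sharp interface (the graded layers Λ₁, …, Λ_{k−1} of (3.16) are NOT modelled):

 * §1 OBJECTS on the STAR bonds of `Ω₀ = blockReg S₀` for a pair `S₁ ≤ S₀`: the COLLAR `collar S₀ S₁ = star(S₀) ∖ star(S₁)` and its
   coordinate map `selC`; the gauge gradient **`gradR₂ = (∂)_{star(S₀), Ω₁}`** (gauge functions supported in `Ω₁ = blockReg S₁`); the
   mass map **`Qv₂ = fromRows (√(n^d)·avgR S₀) (n·selC)`**, so that `a·Qv₂ᴴQv₂ = a n^d·QᴴQ + a n²·1_collar` = unit-block averaging mass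
   plus (3.16)'s `j = 0` η-scale collar mass in lattice units; the scalar data of Ω₁ are gen 5's / road P2's `DOm`, `GOm S₁`, `QOm S₁` BY NAME.
 * §2 **`sliceData_twoZone (hsub : S₁ ≤ S₀)`**: the structural identities of `RegionGaugeSlice.SliceData` — `curlR S₀·gradR₂ = 0`,
   `Qv₂·gradR₂ = Dg₁₂·QOm S₁` (the collar rows ANNIHILATE `gradR₂λ` because `λ ⊂ Ω₁`; the unit rows are «Q∂ = ∂₁Q′» through the region),
   `gradR₂ᴴgradR₂ = (−Δ)_{Ω₁Ω₁}`, `G′(Ω₁)` two-sided Hermitian inverse, `Q′G′²Q′ᴴ` invertible.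
 * §3 **`regionDeltaA₂ := gaugeFixed (curlR S₀) gradR₂ (GOm S₁) (QOm S₁) Qv₂ a`** = `Ω₀(∂*∂)Ω₀ + ∂_{Ω₁}R(Ω₁)∂_{Ω₁}* + a n^d QᴴQ + a n² 1_collar`;
   its form; ENDs from gen 5's reduction BY NAME: **`opNorm_inv_regionDeltaA₂_le_of_slice`** (`SliceCoercive₂ … c → ‖G₂(Ω₀)‖ ≤ max(2/c, 2γ′⁻¹)`),
   the converse `sliceCoercive_twoZone_of_coercive`, and **`isUnit_det_regionDeltaA₂ (hsub) (0 < a) (0 < a′)`** — «G₂(Ω₀) exists» for EVERY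
   pair `S₁ ≤ S₀` (flatness: gen 5's `flat_region` on Ω₁ after the collar components are forced to vanish).

THE ONE DISPLAYED INEQUALITY here is `SliceCoercive₂ := SliceCoercive (curlR S₀) gradR₂ (GOm S₁) (QOm S₁) Qv₂ a c`: for every `A` on star(S₀)
with `R(Ω₁)·∂_{Ω₁}*A = 0`, `c‖A‖² ≤ ‖curl A‖² + a n^d‖QA‖² + a n²‖A_collar‖²`.  File 2 proves it EQUIVALENT (constants `d, a`) to gen 5's
single-zone `SliceCoercive` of the INNER region `S₁` — the located open estimate G-ne2leaf07g5-1 is intrinsic to the interface ∂Ω₁.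

HONEST FRAMING (T4-DAG p. 1).  Model level (`U = 1`, two zones with ONE sharp interface, finite torus, operator norm); [folklore] finite-
dimensional algebra over landed modules; `[cite:]` tags locate SHAPES; the slice inequality is DISPLAYED, not proved; NOT [B9] (3.16)/(3.23)–(3.27)
as printed (no graded layers, no background field); NE2 (U1a) NOT proved; spine 0/9 unchanged; NOT infinite volume / mass gap / Clay / summit
progress.  HONEST DEPENDENCY: continuum YM on T⁴ ⇐ BetaPertH ∧ nine spine estimates (0/9 proved); BetaPertH ⇐ (D1) ∧ (D4) ∧ CAP+tail; G-an2-4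
gates asym, D1 and NE2/3/4.  No `sorry`.
-/

noncomputable section

open scoped BigOperators ComplexConjugate Matrix Matrix.Norms.L2Operator
open Finset

namespace Summit.QuantumFields.BalabanUV.T4Continuum.RegionGaugeTwoZone

open Literature.MathematicalPhysics.QuantumFieldTheory.Balaban1983to89.B5Prop11Plancherel (Tor fine unitVec)
open Literature.MathematicalPhysics.QuantumFieldTheory.Balaban1983to89.B5Prop11Lower (nsq nsq_nonneg)
open Literature.MathematicalPhysics.QuantumFieldTheory.Balaban1983to89.B5Action121 (LapS GradOp CurlOp)
open Literature.MathematicalPhysics.QuantumFieldTheory.Balaban1983to89.B5Block118 (QsOp QvOp)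
open Literature.MathematicalPhysics.QuantumFieldTheory.Balaban1983to89.B5Blocks16 (blockOf)
open Summit.QuantumFields.BalabanUV.T4Continuum
open Summit.QuantumFields.BalabanUV.T4Continuum.SubtypeCompression (Coercive ext ext_apply_of ext_apply_of_not nsq_ext toBlock_add
  toBlock_smul)
open Summit.QuantumFields.BalabanUV.T4Continuum.ScalarBlockPoincare (PiS nsq_smul)
open Summit.QuantumFields.BalabanUV.T4Continuum.ScalarAveragedPropagator (DeltaPs gammaPs gammaPs_pos)
open Summit.QuantumFields.BalabanUV.T4Continuum.RegionGaugeProjection (gramK gaugeR)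
open Summit.QuantumFields.BalabanUV.T4Continuum.RegionGaugeSlice (gaugeFixed SliceData SliceCoercive coercive_gaugeFixed_of_slice
  isUnit_det_gaugeFixed_of_slice opNorm_inv_gaugeFixed_le_of_slice sliceCoercive_of_coercive form_gaugeFixed isUnit_det_gaugeFixed_of_flat)
open Summit.QuantumFields.BalabanUV.T4Continuum.RegionScalarCompression (QOm GOm GOm_isHermitian GOm_mul_DOm DOm_mul_GOm
  isUnit_det_gramK_region)
open Summit.QuantumFields.BalabanUV.T4Continuum.RegionGaugeFixedVector (starReg curlR gradR avgR grad₁R sum_star_eq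
  GradOp_apply_eq_zero_of_not_star QvOp_mul_GradOp_apply QsOp_apply_eq_zero CurlOp_mul_GradOp_apply toBlock_PiS)
open Summit.QuantumFields.BalabanUV.T4Continuum.RegionGaugeFixedVectorFlat (submatrix_mulVec_eq avgR_mulVec flat_region)
open Summit.QuantumFields.BalabanUV.T4Continuum.RegionGaugeSliceTorus (curlR_mulVec)
open Summit.QuantumFields.BalabanUV.Beta.GAN24.DirichletBoxCompression (DOm opNorm_inv_DOm_le)
open Summit.QuantumFields.BalabanUV.Beta.GAN24.DirichletBoxTrace (blockReg)

variable {d : ℕ}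

section Objects

variable (n : ℕ) [NeZero n] (M : Fin d → ℕ) [hM : ∀ μ, NeZero (M μ)] (a a' : ℝ) (S₀ S₁ : Tor M → Prop)
  [DecidablePred S₀] [DecidablePred S₁]

/-! ## §1 The two-zone objects on the star bonds of `Ω₀` -/

/-- the COLLAR bonds: star bonds of `Ω₀` that are not star bonds of `Ω₁` (the bonds carrying (3.16)'s `j = 0` η-scale mass).
[cite: Balaban1985BackgroundPropagators, (3.16) p.393 (shape: the layer Λ₀)] [folklore] -/
def collar : Tor (fine n M) × Fin d → Prop := fun b => starReg n M S₀ b ∧ ¬ starReg n M S₁ b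

/-- decidability of the collar predicate. [folklore] -/
instance decCollar : DecidablePred (collar n M S₀ S₁) := fun b =>
  inferInstanceAs (Decidable (starReg n M S₀ b ∧ ¬ starReg n M S₁ b))

/-- the collar coordinates of a field on the star bonds of `Ω₀`. [folklore] -/
def selC : Matrix {b // collar n M S₀ S₁ b} {b // starReg n M S₀ b} ℂ :=
  fun c b => if (c : Tor (fine n M) × Fin d) = (b : Tor (fine n M) × Fin d) then 1 else 0

omit [DecidablePred S₁] in
/-- `selC` reads off the collar components. [folklore] -/
theorem selC_mulVec (A : {b // starReg n M S₀ b} → ℂ) :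
    selC n M S₀ S₁ *ᵥ A = fun c => A ⟨c.1, c.2.1⟩ := by
  funext c
  rw [Matrix.mulVec, dotProduct, Finset.sum_eq_single ⟨c.1, c.2.1⟩]
  · simp [selC]
  · intro b _ hb
    have : (c : Tor (fine n M) × Fin d) ≠ (b : Tor (fine n M) × Fin d) := fun h => hb (Subtype.ext h.symm)
    simp [selC, this]
  · intro h; exact absurd (Finset.mem_univ _) h

/-- THE GAUGE GRADIENT of the two-zone model: Dirichlet scalars on `Ω₁` to the star bonds of `Ω₀` («the functions λ … vanish on Ω₁ᶜ»).
[cite: Balaban1985BackgroundPropagators, (3.22) p.394 (shape)] [folklore] -/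
def gradR₂ : Matrix {b // starReg n M S₀ b} {x // blockReg n M S₁ x} ℂ :=
  (GradOp (fine n M) (n : ℂ)).toBlock (starReg n M S₀) (blockReg n M S₁)

/-- THE MASS MAP of the two-zone model: unit-block averaging (weight `√(n^d)`, so that `a·(√(n^d)Q)ᴴ(√(n^d)Q) = a·Q_adj·Q`) stacked with
the collar coordinates (weight `n = η⁻¹`, (3.16)'s `j = 0` mass `a η^{−2}` in lattice units). [cite: Balaban1985BackgroundPropagators, (3.16) p.393 (shape)] [folklore] -/
def Qv₂ : Matrix ((Tor M × Fin d) ⊕ {b // collar n M S₀ S₁ b}) {b // starReg n M S₀ b} ℂ :=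
  Matrix.fromRows ((((Real.sqrt ((n : ℝ) ^ d)) : ℝ) : ℂ) • avgR n M S₀) ((n : ℂ) • selC n M S₀ S₁)

/-- the unit-lattice gradient stacked with zero (the intertwiner of «Q∂ = ∂₁Q′» for `Qv₂`). [folklore] -/
def Dg₁₂ : Matrix ((Tor M × Fin d) ⊕ {b // collar n M S₀ S₁ b}) {y // S₁ y} ℂ :=
  Matrix.fromRows ((((Real.sqrt ((n : ℝ) ^ d)) : ℝ) : ℂ) • grad₁R M S₁) 0

omit [DecidablePred S₀] [DecidablePred S₁] in
/-- `S₁ ≤ S₀` ⟹ `star(S₁) ⊆ star(S₀)`. [folklore] -/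
theorem starReg_mono (hsub : ∀ y, S₁ y → S₀ y) {b : Tor (fine n M) × Fin d} (hb : starReg n M S₁ b) : starReg n M S₀ b :=
  hb.imp (hsub _) (hsub _)

/-- `‖Qv₂ A‖² = n^d‖QA‖² + n²‖A_collar‖²`. [folklore] -/
theorem nsq_Qv₂_mulVec (A : {b // starReg n M S₀ b} → ℂ) :
    nsq (Qv₂ n M S₀ S₁ *ᵥ A) = (n : ℝ) ^ d * nsq (avgR n M S₀ *ᵥ A) + (n : ℝ) ^ 2 * nsq (selC n M S₀ S₁ *ᵥ A) := by
  have hn : (0 : ℝ) ≤ (n : ℝ) ^ d := by positivity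
  rw [Qv₂, Matrix.fromRows_mulVec, Matrix.smul_mulVec, Matrix.smul_mulVec]
  unfold nsq
  rw [Fintype.sum_sum_type]
  simp only [Sum.elim_inl, Sum.elim_inr, Pi.smul_apply, smul_eq_mul, norm_mul, mul_pow, Complex.norm_real, Real.norm_of_nonneg
    (Real.sqrt_nonneg _), Real.sq_sqrt hn, Complex.norm_natCast, ← Finset.mul_sum]

/-! ## §2 The structural identities `SliceData` of the two-zone model -/

omit [DecidablePred S₁] in
/-- `curlR S₀·gradR₂ = 0` (curl ∘ grad on the torus; the star bonds of `Ω₀` carry the whole gradient of a scalar supported in `Ω₁ ⊆ Ω₀`). [folklore] -/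
theorem curlR_mul_gradR₂ (hsub : ∀ y, S₁ y → S₀ y) : curlR n M S₀ * gradR₂ n M S₀ S₁ = 0 := by
  ext p x
  rw [Matrix.mul_apply, Matrix.zero_apply]
  simp only [curlR, gradR₂, Matrix.smul_apply, Matrix.submatrix_apply, Matrix.toBlock_apply, id, smul_eq_mul, mul_assoc]
  rw [← Finset.mul_sum, sum_star_eq n M S₀ (f := fun b => CurlOp (fine n M) (n : ℂ) p b * GradOp (fine n M) (n : ℂ) b x.1)
    fun b hb => by rw [GradOp_apply_eq_zero_of_not_star n M S₀ hb (hsub _ x.2), mul_zero]]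
  rw [← Matrix.mul_apply, CurlOp_mul_GradOp_apply, mul_zero]

/-- «Q∂ = ∂₁Q′» through the two zones: `avgR S₀·gradR₂ = grad₁R S₁·QOm S₁`. [cite: Balaban1984PropagatorsI, (1.55) p.27] [folklore] -/
theorem avgR_mul_gradR₂ (hsub : ∀ y, S₁ y → S₀ y) : avgR n M S₀ * gradR₂ n M S₀ S₁ = grad₁R M S₁ * QOm n M S₁ := by
  ext i x
  rw [Matrix.mul_apply, Matrix.mul_apply]
  simp only [avgR, gradR₂, grad₁R, QOm, Matrix.submatrix_apply, Matrix.toBlock_apply, id]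
  rw [sum_star_eq n M S₀ (f := fun b => QvOp n M i b * GradOp (fine n M) (n : ℂ) b x.1)
    fun b hb => by rw [GradOp_apply_eq_zero_of_not_star n M S₀ hb (hsub _ x.2), mul_zero]]
  rw [← Matrix.mul_apply, QvOp_mul_GradOp_apply, Matrix.mul_apply,
    ← Fintype.sum_subtype_add_sum_subtype S₁ (fun y => GradOp M 1 i y * QsOp n M y x.1)]
  have h2 : ∑ y : {y // ¬ S₁ y}, GradOp M 1 i y * QsOp n M y x.1 = 0 :=
    Finset.sum_eq_zero fun y _ => by
      have hx : S₁ (blockOf n M x.1) := x.2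
      rw [QsOp_apply_eq_zero n M (fun h => y.2 (by rw [← h]; exact hx)), mul_zero]
  rw [h2, add_zero]

omit [DecidablePred S₁] in
/-- THE COLLAR ROWS ANNIHILATE THE GAUGE GRADIENT: `selC·gradR₂ = 0` (a collar bond is not a star bond of `Ω₁`, so the gradient of a scalar
supported in `Ω₁` vanishes on it). [cite: Balaban1985BackgroundPropagators, p.394 «the functions λ … vanish on Ω₁ᶜ» (shape)] [folklore] -/
theorem selC_mul_gradR₂ : selC n M S₀ S₁ * gradR₂ n M S₀ S₁ = 0 := by
  ext c x
  rw [Matrix.mul_apply, Matrix.zero_apply, Finset.sum_eq_single ⟨c.1, c.2.1⟩]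
  · simp only [selC, gradR₂, Matrix.toBlock_apply, if_true]
    rw [GradOp_apply_eq_zero_of_not_star n M S₁ c.2.2 x.2, mul_zero]
  · intro b _ hb
    have : (c : Tor (fine n M) × Fin d) ≠ (b : Tor (fine n M) × Fin d) := fun h => hb (Subtype.ext h.symm)
    simp [selC, this]
  · intro h; exact absurd (Finset.mem_univ _) h

/-- `Qv₂·gradR₂ = Dg₁₂·QOm S₁`. [folklore] -/
theorem Qv₂_mul_gradR₂ (hsub : ∀ y, S₁ y → S₀ y) : Qv₂ n M S₀ S₁ * gradR₂ n M S₀ S₁ = Dg₁₂ n M S₀ S₁ * QOm n M S₁ := by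
  rw [Qv₂, Dg₁₂, Matrix.fromRows_mul, Matrix.fromRows_mul, Matrix.smul_mul, Matrix.smul_mul, Matrix.smul_mul, Matrix.zero_mul,
    avgR_mul_gradR₂ n M S₀ S₁ hsub, selC_mul_gradR₂, smul_zero]

omit [DecidablePred S₁] in
/-- `gradR₂ᴴ·gradR₂ = (−Δ)_{Ω₁Ω₁}` EXACTLY. [cite: Balaban1985BackgroundPropagators, (3.24) p.394 (shape)] [folklore] -/
theorem gradR₂_conjTranspose_mul_gradR₂ (hsub : ∀ y, S₁ y → S₀ y) :
    (gradR₂ n M S₀ S₁)ᴴ * gradR₂ n M S₀ S₁ = (LapS (fine n M) (n : ℂ)).toBlock (blockReg n M S₁) (blockReg n M S₁) := by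
  ext x x'
  rw [← Literature.MathematicalPhysics.QuantumFieldTheory.Balaban1983to89.B5Action121.GradOp_conjTranspose_mul_GradOp]
  simp only [Matrix.mul_apply, Matrix.conjTranspose_apply, gradR₂, Matrix.toBlock_apply]
  exact sum_star_eq n M S₀ (f := fun b => star (GradOp (fine n M) (n : ℂ) b x.1) * GradOp (fine n M) (n : ℂ) b x'.1)
    fun b hb => by rw [GradOp_apply_eq_zero_of_not_star n M S₀ hb (hsub _ x'.2), mul_zero]

/-- on `N(Q′_{Ω₁})` the scalar operator of `Ω₁` is `gradR₂ᴴ·gradR₂`. [cite: Balaban1985BackgroundPropagators, (3.24) p.394 (shape)] [folklore] -/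
theorem DOm_mulVec_of_ker₂ (hsub : ∀ y, S₁ y → S₀ y) (lam : {x // blockReg n M S₁ x} → ℂ) (h : QOm n M S₁ *ᵥ lam = 0) :
    DOm n M a' (blockReg n M S₁) *ᵥ lam = (gradR₂ n M S₀ S₁)ᴴ *ᵥ (gradR₂ n M S₀ S₁ *ᵥ lam) := by
  rw [Matrix.mulVec_mulVec, gradR₂_conjTranspose_mul_gradR₂ n M S₀ S₁ hsub]
  unfold DOm DeltaPs
  rw [toBlock_add, toBlock_smul, toBlock_PiS, Matrix.add_mulVec, Matrix.smul_mulVec, Matrix.smul_mulVec, ← Matrix.mulVec_mulVec,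
    h, Matrix.mulVec_zero, smul_zero, smul_zero, add_zero]

/-- **THE STRUCTURAL IDENTITIES OF `SliceData` HOLD FOR THE TWO-ZONE OBJECTS** (`S₁ ≤ S₀`, `0 < a′`).
[cite: Balaban1985BackgroundPropagators, (3.16)/(3.21)–(3.26) pp.393–395 (shapes)] [folklore] -/
theorem sliceData_twoZone (hsub : ∀ y, S₁ y → S₀ y) (ha' : 0 < a') :
    SliceData (curlR n M S₀) (gradR₂ n M S₀ S₁) (DOm n M a' (blockReg n M S₁)) (GOm n M a' S₁) (QOm n M S₁)
      (Qv₂ n M S₀ S₁) (Dg₁₂ n M S₀ S₁) where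
  curl_grad := curlR_mul_gradR₂ n M S₀ S₁ hsub
  avg_grad := Qv₂_mul_gradR₂ n M S₀ S₁ hsub
  lap_of_ker := DOm_mulVec_of_ker₂ n M a' S₀ S₁ hsub
  herm := GOm_isHermitian n M a' S₁
  G_mul := GOm_mul_DOm n M a' S₁ ha'
  mul_G := DOm_mul_GOm n M a' S₁ ha'
  gram_unit := isUnit_det_gramK_region n M a' S₁ ha'

/-! ## §3 The two-zone operator, its inverse from ONE displayed slice inequality, and its unconditional existence -/

/-- **THE TWO-ZONE `U = 1` REGION VECTOR OPERATOR** `Δ₂(Ω₀,Ω₁) = Ω₀(∂*∂)Ω₀ + ∂_{Ω₁}·R(Ω₁)·∂_{Ω₁}ᴴ + a n^d·QᴴQ + a n²·1_collar` on the star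
bonds of `Ω₀`. [cite: Balaban1985BackgroundPropagators, (3.16)/(3.26)–(3.27) pp.393–395 (shape)] [folklore] -/
def regionDeltaA₂ : Matrix {b // starReg n M S₀ b} {b // starReg n M S₀ b} ℂ :=
  gaugeFixed (curlR n M S₀) (gradR₂ n M S₀ S₁) (GOm n M a' S₁) (QOm n M S₁) (Qv₂ n M S₀ S₁) a

/-- its quadratic form: `Re⟨A, Δ₂A⟩ = ‖curl A‖² + ‖R(Ω₁)·∂_{Ω₁}ᴴA‖² + a·(n^d‖QA‖² + n²‖A_collar‖²)`. [folklore] -/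
theorem form_regionDeltaA₂ (ha' : 0 < a') (A : {b // starReg n M S₀ b} → ℂ) :
    (star A ⬝ᵥ (regionDeltaA₂ n M a a' S₀ S₁ *ᵥ A)).re
      = nsq (curlR n M S₀ *ᵥ A) + nsq (gaugeR (GOm n M a' S₁) (QOm n M S₁) *ᵥ ((gradR₂ n M S₀ S₁)ᴴ *ᵥ A))
          + a * ((n : ℝ) ^ d * nsq (avgR n M S₀ *ᵥ A) + (n : ℝ) ^ 2 * nsq (selC n M S₀ S₁ *ᵥ A)) := by
  rw [regionDeltaA₂, form_gaugeFixed _ _ _ _ _ _ (GOm_isHermitian n M a' S₁) (isUnit_det_gramK_region n M a' S₁ ha') A, nsq_Qv₂_mulVec]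

/-- **«G₂(Ω₀) BOUND» FROM ONE SLICE INEQUALITY**: `SliceCoercive₂ … c ⟹ ‖Δ₂⁻¹‖ ≤ (min(c/2, γ′/2))⁻¹`, `γ′ = gammaPs d a′` — gen 5's reduction
BY NAME. [cite: Balaban1985BackgroundPropagators, (3.27) p.395 (shape)] [folklore] -/
theorem opNorm_inv_regionDeltaA₂_le_of_slice (hsub : ∀ y, S₁ y → S₀ y) (ha' : 0 < a') {c : ℝ} (hc : 0 < c)
    (hS : SliceCoercive (curlR n M S₀) (gradR₂ n M S₀ S₁) (GOm n M a' S₁) (QOm n M S₁) (Qv₂ n M S₀ S₁) a c) :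
    ‖(regionDeltaA₂ n M a a' S₀ S₁)⁻¹‖ ≤ (min (c / 2) (1 / (2 * (gammaPs d a')⁻¹)))⁻¹ :=
  opNorm_inv_gaugeFixed_le_of_slice _ (sliceData_twoZone n M a' S₀ S₁ hsub ha') hc hS (opNorm_inv_DOm_le n M a' (blockReg n M S₁) ha')
    (inv_pos.mpr (gammaPs_pos (d := d) (a' := a')).1)

/-- … and invertibility from the slice inequality. [folklore] -/
theorem isUnit_det_regionDeltaA₂_of_slice (hsub : ∀ y, S₁ y → S₀ y) (ha' : 0 < a') {c : ℝ} (hc : 0 < c)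
    (hS : SliceCoercive (curlR n M S₀) (gradR₂ n M S₀ S₁) (GOm n M a' S₁) (QOm n M S₁) (Qv₂ n M S₀ S₁) a c) :
    IsUnit (regionDeltaA₂ n M a a' S₀ S₁).det :=
  isUnit_det_gaugeFixed_of_slice _ (sliceData_twoZone n M a' S₀ S₁ hsub ha') hc hS (opNorm_inv_DOm_le n M a' (blockReg n M S₁) ha')
    (inv_pos.mpr (gammaPs_pos (d := d) (a' := a')).1)

/-- conversely a coercivity constant of `Δ₂` IS a slice constant. [folklore] -/
theorem sliceCoercive_twoZone_of_coercive (ha' : 0 < a') {γ : ℝ} (h : Coercive (regionDeltaA₂ n M a a' S₀ S₁) γ) :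
    SliceCoercive (curlR n M S₀) (gradR₂ n M S₀ S₁) (GOm n M a' S₁) (QOm n M S₁) (Qv₂ n M S₀ S₁) a γ :=
  sliceCoercive_of_coercive _ (GOm_isHermitian n M a' S₁) (isUnit_det_gramK_region n M a' S₁ ha') h

/-- the INNER PART of a field on the star bonds of `Ω₀`: its restriction to the star bonds of `Ω₁`. [folklore] -/
def inner (hsub : ∀ y, S₁ y → S₀ y) (A : {b // starReg n M S₀ b} → ℂ) : {b // starReg n M S₁ b} → ℂ :=
  fun b => A ⟨b.1, starReg_mono n M S₀ S₁ hsub b.2⟩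

/-- if the collar components vanish, the zero-extension of `A` from star(S₀) IS the zero-extension of its inner part from star(S₁). [folklore] -/
theorem ext_eq_ext_inner (hsub : ∀ y, S₁ y → S₀ y) (A : {b // starReg n M S₀ b} → ℂ) (hcol : selC n M S₀ S₁ *ᵥ A = 0) :
    ext (starReg n M S₀) A = ext (starReg n M S₁) (inner n M S₀ S₁ hsub A) := by
  funext b
  by_cases h1 : starReg n M S₁ b
  · rw [ext_apply_of _ _ ⟨b, h1⟩]
    exact ext_apply_of _ _ ⟨b, starReg_mono n M S₀ S₁ hsub h1⟩
  · rw [ext_apply_of_not _ _ h1]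
    by_cases h0 : starReg n M S₀ b
    · have h := congrFun hcol ⟨b, h0, h1⟩
      rw [selC_mulVec] at h
      exact (ext_apply_of (starReg n M S₀) A ⟨b, h0⟩).trans h
    · exact ext_apply_of_not _ _ h0

/-- **«G₂(Ω₀) EXISTS» FOR EVERY PAIR `S₁ ≤ S₀`** (`0 < a`, `0 < a′`): a curl-free field with zero averages AND zero collar components is the
gradient of a Dirichlet scalar of `Ω₁` with zero block averages (gen 5's `flat_region` on the inner part), hence `Δ₂` is injective.
[cite: Balaban1985BackgroundPropagators, (3.27) p.395 (shape: existence of G)] [folklore] -/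
theorem isUnit_det_regionDeltaA₂ (hsub : ∀ y, S₁ y → S₀ y) (ha : 0 < a) (ha' : 0 < a') :
    IsUnit (regionDeltaA₂ n M a a' S₀ S₁).det := by
  refine isUnit_det_gaugeFixed_of_flat _ (sliceData_twoZone n M a' S₀ S₁ hsub ha') ha ?_
  intro A hC hQ
  -- the collar components and the unit averages vanish
  rw [Qv₂, Matrix.fromRows_mulVec, Matrix.smul_mulVec, Matrix.smul_mulVec] at hQ
  have hsq : ((((Real.sqrt ((n : ℝ) ^ d)) : ℝ) : ℂ)) ≠ 0 := by
    have : 0 < Real.sqrt ((n : ℝ) ^ d) := Real.sqrt_pos.mpr (pow_pos (by exact_mod_cast Nat.pos_of_ne_zero (NeZero.ne n)) d)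
    exact_mod_cast this.ne'
  have hnC : (n : ℂ) ≠ 0 := by exact_mod_cast NeZero.ne n
  have hQ1 : avgR n M S₀ *ᵥ A = 0 := by
    have h := congrArg (fun v => v ∘ Sum.inl) hQ
    simp only [Function.comp_def, Sum.elim_inl, Pi.zero_apply] at h
    exact (smul_eq_zero.mp (funext fun i => congrFun h i)).resolve_left hsq
  have hcol : selC n M S₀ S₁ *ᵥ A = 0 := by
    have h := congrArg (fun v => v ∘ Sum.inr) hQ
    simp only [Function.comp_def, Sum.elim_inr, Pi.zero_apply] at h
    exact (smul_eq_zero.mp (funext fun i => congrFun h i)).resolve_left hnC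
  have hext := ext_eq_ext_inner n M S₀ S₁ hsub A hcol
  -- the inner part is curl-free with zero averages, hence a pure gauge of Ω₁
  have hC1 : curlR n M S₁ *ᵥ inner n M S₀ S₁ hsub A = 0 := by
    rw [curlR_mulVec, ← hext, ← curlR_mulVec]; exact hC
  have hQ1' : avgR n M S₁ *ᵥ inner n M S₀ S₁ hsub A = 0 := by
    rw [avgR_mulVec, ← hext, ← avgR_mulVec]; exact hQ1
  obtain ⟨lam, hlam, hA1⟩ := flat_region n M S₁ (inner n M S₀ S₁ hsub A) hC1 hQ1'
  refine ⟨lam, hlam, ?_⟩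
  funext b
  by_cases h1 : starReg n M S₁ b.1
  · -- on a star bond of Ω₁ both sides are the inner values
    have e1 : A b = inner n M S₀ S₁ hsub A ⟨b.1, h1⟩ := rfl
    rw [e1, hA1]
    simp only [gradR, gradR₂, Matrix.mulVec, dotProduct, Matrix.toBlock_apply]
  · -- on a collar bond both sides vanish
    have e1 : A b = 0 := by
      have h := congrFun hcol ⟨b.1, b.2, h1⟩
      rwa [selC_mulVec] at h
    rw [e1]
    simp only [gradR₂, Matrix.mulVec, dotProduct, Matrix.toBlock_apply]
    exact (Finset.sum_eq_zero fun x _ => by rw [GradOp_apply_eq_zero_of_not_star n M S₁ h1 x.2, zero_mul]).symm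

end Objects

end Summit.QuantumFields.BalabanUV.T4Continuum.RegionGaugeTwoZone

end
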